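import Mathlib
import Summits.ValiantsHypothesis.ValiantsHypothesis.Statement
import Summits.ValiantsHypothesis.ValiantsHypothesis.Theorems.SoloInformedQuadSpanWindow
import HarnessLib

/-!
# Balanced freeness (soloist dossier, quadspan 2.68; u74)

`SoloNatFree K h E` forbids every integer relation `∑ c_e e = 0` on `E` with support `≤ K` and
height `≤ h`; it is not invariant under translation or reflection of `E`.  All girth tools of the
dossier use only BALANCED relations (`∑ c_e = 0` as well).  This file records the balanced notion
`SoloBalFree K h E` and the elementary transfers:

* `SoloNatFree.balFree` : free ⟹ balanced-free;
* `SoloBalFree.anti`, `SoloBalFree.shift`, `SoloBalFree.reflect` : subsets, translates `E + c₀`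
  and reflections `n − E` of balanced-free sets are balanced-free;
* `SoloBalFree.natFree_shift` : if `K·h·max E < c₀` then `E + c₀` is `(K,h)`-FREE — so every
  statement proved under `SoloNatFree` applies to a balanced-free set after a translation;
* `SoloBalFree.of_natFree_shift` : conversely, freeness of some translate gives balanced freeness.
-/

namespace Summit.ValiantsHypothesis.ValiantsHypothesis.Theorems

open Finset

/-- `E ⊂ ℕ` is BALANCED `(K,h)`-free: no nontrivial integer relation `∑ c_e = 0 ∧ ∑ c_e·e = 0`
with at most `K` nonzero coefficients, all of absolute value `≤ h`. -/
def SoloBalFree (K h : ℕ) (E : Finset ℕ) : Prop :=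
  ∀ c : ℕ → ℤ, (E.filter fun e => c e ≠ 0).card ≤ K → (∀ e, |c e| ≤ h) →
    (∑ e ∈ E, c e) = 0 → (∑ e ∈ E, c e * (e : ℤ)) = 0 → ∀ e ∈ E, c e = 0

/-- Free sets are balanced-free. -/
theorem SoloNatFree.balFree {K h : ℕ} {E : Finset ℕ} (hE : SoloNatFree K h E) :
    SoloBalFree K h E :=
  fun c hc hch _ hsum => hE c hc hch hsum

/-- Support size is preserved under reindexing along a map injective on `E`. -/
theorem solo_card_filter_image {E : Finset ℕ} {f : ℕ → ℕ} (hf : Set.InjOn f E) (c : ℕ → ℤ) :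
    ((E.image f).filter fun x => c x ≠ 0).card = (E.filter fun e => c (f e) ≠ 0).card := by
  classical
  rw [Finset.filter_image, Finset.card_image_of_injOn]
  exact hf.mono (by
    intro x hx
    exact (Finset.mem_filter.mp (Finset.mem_coe.mp hx)).1)

/-- Subsets of balanced-free sets are balanced-free. -/
theorem SoloBalFree.anti {K h : ℕ} {E E' : Finset ℕ} (hE : SoloBalFree K h E) (hsub : E' ⊆ E) :
    SoloBalFree K h E' := by
  classical
  intro c hc hch hsum0 hsum e he
  set c' : ℕ → ℤ := fun x => if x ∈ E' then c x else 0 with hc'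
  have hfil : (E.filter fun x => c' x ≠ 0) = E'.filter fun x => c x ≠ 0 := by
    ext x
    simp only [mem_filter, hc']
    constructor
    · rintro ⟨-, hx⟩
      by_cases hxE : x ∈ E'
      · rw [if_pos hxE] at hx; exact ⟨hxE, hx⟩
      · rw [if_neg hxE] at hx; exact (hx rfl).elim
    · rintro ⟨hxE, hx⟩
      exact ⟨hsub hxE, by rw [if_pos hxE]; exact hx⟩
  have h1 : (E.filter fun x => c' x ≠ 0).card ≤ K := by rw [hfil]; exact hc
  have h2 : ∀ x, |c' x| ≤ h := by
    intro x; simp only [hc']; split_ifs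
    · exact hch x
    · simp
  have hext : ∀ g : ℕ → ℤ, (∑ x ∈ E, c' x * g x) = ∑ x ∈ E', c x * g x := by
    intro g
    rw [← Finset.sum_subset hsub (f := fun x => c' x * g x)]
    · apply Finset.sum_congr rfl
      intro x hx; simp only [hc', if_pos hx]
    · intro x _ hx; simp only [hc', if_neg hx, zero_mul]
  have h3 : (∑ x ∈ E, c' x) = 0 := by
    have := hext (fun _ => 1)
    simp only [mul_one] at this
    rw [this, hsum0]
  have h4 : (∑ x ∈ E, c' x * (x : ℤ)) = 0 := by rw [hext, hsum]
  have h5 := hE c' h1 h2 h3 h4 e (hsub he)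
  simp only [hc', if_pos he] at h5
  exact h5

/-- Translates of balanced-free sets are balanced-free. -/
theorem SoloBalFree.shift {K h : ℕ} {E : Finset ℕ} (hE : SoloBalFree K h E) (c₀ : ℕ) :
    SoloBalFree K h (E.image (· + c₀)) := by
  classical
  have hinj : Set.InjOn (fun e : ℕ => e + c₀) E := fun a _ b _ hab => by simpa using hab
  intro c hc hch hsum0 hsum x hx
  obtain ⟨e, he, rfl⟩ := Finset.mem_image.mp hx
  have h1 : (E.filter fun e => c (e + c₀) ≠ 0).card ≤ K := by
    rw [← solo_card_filter_image hinj]; exact hc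
  have h0 : (∑ e ∈ E, c (e + c₀)) = 0 := by rw [← Finset.sum_image hinj]; exact hsum0
  have h2 : (∑ e ∈ E, c (e + c₀) * (e : ℤ)) = 0 := by
    have := hsum
    rw [Finset.sum_image hinj] at this
    have hsplit : (∑ e ∈ E, c (e + c₀) * ((e + c₀ : ℕ) : ℤ)) =
        (∑ e ∈ E, c (e + c₀) * (e : ℤ)) + (c₀ : ℤ) * ∑ e ∈ E, c (e + c₀) := by
      rw [Finset.mul_sum, ← Finset.sum_add_distrib]
      apply Finset.sum_congr rfl
      intro e _
      push_cast
      ring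
    rw [hsplit, h0, mul_zero, add_zero] at this
    exact this
  exact hE (fun e => c (e + c₀)) h1 (fun e => hch _) h0 h2 e he

/-- Reflections `n − E` (for `n ≥ max E`) of balanced-free sets are balanced-free. -/
theorem SoloBalFree.reflect {K h : ℕ} {E : Finset ℕ} (hE : SoloBalFree K h E) (n : ℕ)
    (hn : ∀ e ∈ E, e ≤ n) : SoloBalFree K h (E.image (n - ·)) := by
  classical
  have hinj : Set.InjOn (fun e : ℕ => n - e) E := by
    intro a ha b hb hab
    have := hn a ha; have := hn b hb
    simp only at hab
    omega
  intro c hc hch hsum0 hsum x hx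
  obtain ⟨e, he, rfl⟩ := Finset.mem_image.mp hx
  have h1 : (E.filter fun e => c (n - e) ≠ 0).card ≤ K := by
    rw [← solo_card_filter_image hinj]; exact hc
  have h0 : (∑ e ∈ E, c (n - e)) = 0 := by rw [← Finset.sum_image hinj]; exact hsum0
  have h2 : (∑ e ∈ E, c (n - e) * (e : ℤ)) = 0 := by
    have := hsum
    rw [Finset.sum_image hinj] at this
    have hsplit : (∑ e ∈ E, c (n - e) * ((n - e : ℕ) : ℤ)) =
        (n : ℤ) * (∑ e ∈ E, c (n - e)) - ∑ e ∈ E, c (n - e) * (e : ℤ) := by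
      rw [Finset.mul_sum, ← Finset.sum_sub_distrib]
      apply Finset.sum_congr rfl
      intro e he'
      rw [Nat.cast_sub (hn e he')]
      ring
    rw [hsplit, h0, mul_zero, zero_sub, neg_eq_zero] at this
    exact this
  exact hE (fun e => c (n - e)) h1 (fun e => hch _) h0 h2 e he

/-- A short small-height coefficient vector has a small weighted sum: if at most `K` of the `c e`
(`e ∈ E`) are nonzero, `|c e| ≤ h`, and `e ≤ M` on `E`, then `|∑ c_e e| ≤ K·h·M`. -/
theorem solo_abs_sum_le {K h M : ℕ} {E : Finset ℕ} (c : ℕ → ℤ)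
    (hc : (E.filter fun e => c e ≠ 0).card ≤ K) (hch : ∀ e, |c e| ≤ h) (hM : ∀ e ∈ E, e ≤ M) :
    |∑ e ∈ E, c e * (e : ℤ)| ≤ (K * h * M : ℕ) := by
  classical
  rw [← Finset.sum_filter_of_ne (p := fun e => c e ≠ 0) (fun e _ hne => by
    intro hce; exact hne (by rw [hce, zero_mul]))]
  calc |∑ e ∈ E.filter (fun e => c e ≠ 0), c e * (e : ℤ)|
      ≤ ∑ e ∈ E.filter (fun e => c e ≠ 0), |c e * (e : ℤ)| := Finset.abs_sum_le_sum_abs _ _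
    _ ≤ ∑ e ∈ E.filter (fun e => c e ≠ 0), ((h * M : ℕ) : ℤ) := by
        apply Finset.sum_le_sum
        intro e he
        have heM : e ≤ M := hM e (Finset.mem_filter.mp he).1
        rw [abs_mul, Nat.cast_mul]
        have : |(e : ℤ)| = (e : ℤ) := abs_of_nonneg (by positivity)
        rw [this]
        exact mul_le_mul (hch e) (by exact_mod_cast heM) (by positivity) (by positivity)
    _ = ((E.filter (fun e => c e ≠ 0)).card : ℤ) * ((h * M : ℕ) : ℤ) := by
        rw [Finset.sum_const, nsmul_eq_mul]
    _ ≤ (K * h * M : ℕ) := by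
        have : ((E.filter (fun e => c e ≠ 0)).card : ℤ) ≤ K := by exact_mod_cast hc
        push_cast
        rw [mul_assoc]
        exact mul_le_mul_of_nonneg_right this (by positivity)

/-- **Balanced-free ⟹ free after a translation.**  If `K·h·max E < c₀` then `E + c₀` is
`(K,h)`-free: an unbalanced short relation on `E + c₀` would have `|c₀ · ∑ c_e| ≥ c₀ > K·h·max E ≥
|∑ c_e e|`, contradicting `∑ c_e (e + c₀) = 0`. -/
theorem SoloBalFree.natFree_shift {K h : ℕ} {E : Finset ℕ} (hE : SoloBalFree K h E) {M c₀ : ℕ}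
    (hM : ∀ e ∈ E, e ≤ M) (hc₀ : K * h * M < c₀) : SoloNatFree K h (E.image (· + c₀)) := by
  classical
  have hinj : Set.InjOn (fun e : ℕ => e + c₀) E := fun a _ b _ hab => by simpa using hab
  intro c hc hch hsum x hx
  obtain ⟨e, he, rfl⟩ := Finset.mem_image.mp hx
  have h1 : (E.filter fun e => c (e + c₀) ≠ 0).card ≤ K := by
    rw [← solo_card_filter_image hinj]; exact hc
  set S := ∑ e ∈ E, c (e + c₀) with hS
  set T := ∑ e ∈ E, c (e + c₀) * (e : ℤ) with hT
  have hrel : T + (c₀ : ℤ) * S = 0 := by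
    have := hsum
    rw [Finset.sum_image hinj] at this
    have hsplit : (∑ e ∈ E, c (e + c₀) * ((e + c₀ : ℕ) : ℤ)) = T + (c₀ : ℤ) * S := by
      rw [hT, hS, Finset.mul_sum, ← Finset.sum_add_distrib]
      apply Finset.sum_congr rfl
      intro e _
      push_cast
      ring
    rw [hsplit] at this
    exact this
  have hTle : |T| ≤ (K * h * M : ℕ) := solo_abs_sum_le (fun e => c (e + c₀)) h1 (fun e => hch _) hM
  have hS0 : S = 0 := by
    by_contra hS0
    have h1S : 1 ≤ |S| := Int.one_le_abs hS0
    have : (c₀ : ℤ) ≤ |T| := by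
      have hTeq : T = -((c₀ : ℤ) * S) := by linear_combination hrel
      rw [hTeq, abs_neg, abs_mul, Nat.abs_cast]
      nlinarith
    have hc₀' : ((K * h * M : ℕ) : ℤ) < c₀ := by exact_mod_cast hc₀
    omega
  have hT0 : T = 0 := by rw [hS0, mul_zero, add_zero] at hrel; exact hrel
  exact hE (fun e => c (e + c₀)) h1 (fun e => hch _) hS0 hT0 e he

/-- Conversely, if some translate `E + c₀` is `(K,h)`-free then `E` is balanced `(K,h)`-free. -/
theorem SoloBalFree.of_natFree_shift {K h : ℕ} {E : Finset ℕ} {c₀ : ℕ}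
    (hE : SoloNatFree K h (E.image (· + c₀))) : SoloBalFree K h E := by
  classical
  have hinj : Set.InjOn (fun e : ℕ => e + c₀) E := fun a _ b _ hab => by simpa using hab
  intro c hc hch hsum0 hsum e he
  set c' : ℕ → ℤ := fun x => c (x - c₀) with hc'
  have hcomp : ∀ e, c' (e + c₀) = c e := fun e => by simp [hc']
  have h1 : ((E.image (· + c₀)).filter fun x => c' x ≠ 0).card ≤ K := by
    rw [solo_card_filter_image hinj]
    simp only [hcomp]
    exact hc
  have h2 : ∀ x, |c' x| ≤ h := fun x => hch _
  have h3 : (∑ x ∈ E.image (· + c₀), c' x * (x : ℤ)) = 0 := by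
    rw [Finset.sum_image hinj]
    simp only [hcomp]
    have hsplit : (∑ e ∈ E, c e * ((e + c₀ : ℕ) : ℤ)) =
        (∑ e ∈ E, c e * (e : ℤ)) + (c₀ : ℤ) * ∑ e ∈ E, c e := by
      rw [Finset.mul_sum, ← Finset.sum_add_distrib]
      apply Finset.sum_congr rfl
      intro e _
      push_cast
      ring
    rw [hsplit, hsum, hsum0, mul_zero, add_zero]
  have := hE c' h1 h2 h3 (e + c₀) (Finset.mem_image.mpr ⟨e, he, rfl⟩)
  rwa [hcomp] at this

end Summit.ValiantsHypothesis.ValiantsHypothesis.Theorems
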